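import Literature.IUT.HodgeArakelov.RealifiedPrimeStripCategories
import Literature.IUT.HodgeArakelov.KummerPrimeStripSplitCategories

/-!
# [IUTchII] Def 4.9 (viii): the groupoid of `F^{⊩▶×μ}`-prime-strips with PRINT-LEVEL morphisms
# (split local isomorphisms, compatible with the valuations `ρ_v` and the generators at bad places)

Owner file (abc-iut cell, layer L6; abc-iut-L6-t2; nothing landed is re-typed). S. Mochizuki, *Inter-universal
Teichmüller theory II*, kurims Dec-2020 manuscript, Def 4.9 (viii) p. 158: an `F^{⊩▶×μ}`-prime-strip is "a collection
of data `*F^{⊩▶×μ} = (*C^⊩, Prime(*C^⊩) ⥲ V, *F^{⊢▶×μ}, {*ρ_v}_{v∈V})` satisfying the conditions (a)–(f) of [IUTchI],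
Definition 5.2, (iv) … the generators of the monoids `O^▶(−)` [each of which is abstractly isomorphic to `ℕ`] of the
data at `v ∈ V^bad`, together with the `{*ρ_w}_{w∈V}`, determine … the pilot object … A morphism of
`F^{⊩▶×μ}`-prime-strips is defined to be an isomorphism between collections of data as discussed above."
[claim: Mochizuki2012, status: disputed]; nothing here takes a side on [IUTchIII] Cor 3.12.

`RealifiedPrimeStripCategories.lean` gave `FVdashTriMuPrimeStripF P G X` a groupoid structure whose local part is
the `O^▷`-LEVEL `LocalTriMuDatum.Iso` and which (like the frozen `FVdashTriMuIso`) does NOT carry compatibility with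
the valuations `ρ_v : O^▶ → ℝ_{≥0}` (abc-iut-L6-d3's advisory A1). With the print-level split local morphisms
(`LocalTriMuDataSplitIso`, `KummerPrimeStripSplitCategories`: `O^{▶×μ} = O^▶ × O^{×μ}`) the `O^▶`-component `eTri` is
available, so here the LOCAL part of a morphism is the printed isomorphism of local data; the GLOBAL part is carried
on isomorphism classes of `*C^⊩` and is LOOSER THAN PRINT (see the DISCLOSURE below):
* `LocalTriMuDatum.SplitIso.eTri` — the `O^▶`-component by type of place (+ `refl/trans/symm` lemmas);
* `RealifiedGlobalFrobenioidF.IsoClass`, `degClass` — objects of `*C^⊩` UP TO ISOMORPHISM and the degree on classes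
  (abc-iut-w4-d009's design request 23:38Z: morphisms of realified data must act on isomorphism classes and respect
  the `ρ_v`, or the rigidity of [IUTchII] Cor 4.10 (v) / [IUTchIII] Thm 1.5 (v) is false-as-instantiated);
* `FVdashSplitTriMuPrimeStrip P G X` (one-field wrapper of `FVdashTriMuPrimeStripF`) with
  `Hom S T = {classEquiv, degClass_eq, map_pilotClass, locSplitIso, map_rho, map_triGen}`: a bijection of the
  ISOMORPHISM CLASSES of `*C^⊩` respecting degrees and the pilot class, `V`-indexed SPLIT local isomorphisms,
  compatibility `ρ_v ∘ eTri_v = ρ_v` and `eTri_v(generator) = generator` at bad `v`; `Groupoid`; `pilot_deg_eq`;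
* `toSplitStripFunctor : FVdashSplitTriMuPrimeStrip ⥤ FSplitTriMuPrimeStrip` (the `StripFrame.FglxmToFvtxm` shape at
  print level) and kit-rule connectedness `iso_nonempty_of_model`.

DISCLOSURE (v3, doc-only; v2's paragraph corrected at one point (†); declarations byte-identical to v1
d9c41be93ec504c2; abc-iut-L6-t22 RQ7 finding R9-F1, L6-lead ruling §F v1.18e (3)): the GLOBAL component
`Hom.classEquiv` is constrained ONLY by TOTAL degree (`degClass_eq`) and by the pilot class (`map_pilotClass`); it is
NOT tied to the local split isomorphisms.  Print ([IUTchII] Def 4.9 (viii) p. 158 l. 26–27 with [IUTchI] Def 5.2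
(iv) (c) "Prime(‡C^⊩) ⥲ V is a bijection of sets", (e) "‡ρ_v : Φ_{‡C^⊩,v} ⥲ Φ^rlf_{‡C^⊢_v} … is an isomorphism of
topological monoids", kurims I p. 135) glues the `v`-component of the DIVISOR MONOID `Φ_{*C^⊩}` of the global realified
Frobenioid to the realified local divisor monoid at every `v`; a printed isomorphism of collections of data is an
isomorphism of Frobenioids `*C^⊩ ⥲ ‡C^⊩` compatible with `Prime(−) ⥲ V` and with the `ρ_v`, so it acts on the divisor
monoids prime-wise (identically in the `ρ_v`-coordinates, given the local part) and on the ISOMORPHISM CLASSES of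
objects through that isomorphism of Frobenioids — for an automorphism of ONE collection, through a
`ρ_v`-compatible self-equivalence of `*C^⊩`, which is far more restrictive than an arbitrary degree-preserving
permutation of classes.  (†) v2 said "preserves every object's local degree": WRONG at the object level and
withdrawn — local degrees of OBJECTS are not isomorphism invariants (isomorphic objects of `C^⊩_mod` differ by
principal divisors; only the total degree descends, [FrdI] Ex. 6.3 / the product formula), so no class-level
`localDeg` exists and `degClass_eq` is the only Prime-blind class invariant the record `RealifiedGlobalFrobenioidF`
offers.  Hence the morphisms typed here are LOOSER than print: for ANY strip `S`, every permutation of the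
isomorphism classes of `*C^⊩` preserving total degree and fixing the pilot class is an automorphism of `S` with
identity local part (kernel witness `L6t22g9Probe.autOfDegPerm`, cell staging `staging/L6/abc-iut-L6-t22/audit-gen9/`).
Impact on the landed consumers (`StripFrameOfKitsFullness`, `RealifiedPrimeStripSplitMuLift`,
`RealifiedPrimeStripSplitKitRuleWitness`) is NIL: they use only the local part and the pilot object, whose total
degree and local degrees ARE pinned (`Hom.pilot_deg_eq`, `Hom.rho_triGen_eq`, `pilot_localDeg_bad/other`).  It would
matter for a consumer reading the full poly-isomorphism of `F^{⊩▶×μ}`-prime-strips object-wise on `*C^⊩` (non-pilot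
objects).  Root: the record `RealifiedGlobalFrobenioidF` abstracts `*C^⊩` to `(Obj, Iso, deg, localDeg)` WITHOUT its
Frobenioid structure (no divisor-monoid action on objects, no rational-function monoid), so "induced by an
isomorphism of Frobenioids compatible with `Prime` and `ρ_v`" cannot be stated over it; the structural repair —
the global component typed as an isomorphism of (model) realified Frobenioids over the tree's Frobenioid vocabulary,
compatible with `Prime(−) ⥲ V` and the `ρ_v` — is a post-freeze item (D-L6t22-R9F1a; v2's "`localDeg_iso`" recipe
is withdrawn with (†)).
-/

namespace Literature.IUT.HodgeArakelov

open CategoryTheory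

universe u v w

/-! ### 0. The `O^▶`-component of a split local isomorphism, by type of place -/

namespace LocalTriMuDatum

variable {l : ℕ} {G : Type u} [Group G] {X : GroupTheoreticUnits.{u, w} G}

/-- The `O^▶`-component `O^▶(D) ⥲ O^▶(D')` of a split local isomorphism, by type of place.
[cite: Mochizuki2012, Def 4.9 (vii) p.158] -/
def SplitIso.eTri : {k : PlaceKind} → {D D' : LocalTriMuDatum.{u, v, w} l G X k} → SplitIso D D' →
    (OTri D.O ≃* OTri D'.O)
  | _, .bad _, .bad _, f => NonarchTriMuDatum.SplitIso.eTri f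
  | _, .good _, .good _, f => NonarchTriMuDatum.SplitIso.eTri f
  | _, .arch _, .arch _, f => f.down.eTri

variable {k : PlaceKind} {D D' D'' : LocalTriMuDatum.{u, v, w} l G X k}

/-- `eTri (refl) = id`. (bookkeeping). [cite: Mochizuki2012, Def 4.9 (vii) p.158] -/
theorem SplitIso.eTri_refl (D : LocalTriMuDatum.{u, v, w} l G X k) : (SplitIso.refl D).eTri = MulEquiv.refl _ := by
  cases D <;> rfl

/-- `eTri (f ≫ f') = eTri f ≫ eTri f'`. (bookkeeping). [cite: Mochizuki2012, Def 4.9 (vii) p.158] -/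
theorem SplitIso.eTri_trans (f : SplitIso D D') (f' : SplitIso D' D'') :
    (f.trans f').eTri = f.eTri.trans f'.eTri := by
  cases D <;> cases D' <;> cases D'' <;> rfl

/-- `eTri (f⁻¹) = (eTri f)⁻¹`. (bookkeeping). [cite: Mochizuki2012, Def 4.9 (vii) p.158] -/
theorem SplitIso.eTri_symm (f : SplitIso D D') : f.symm.eTri = f.eTri.symm := by
  cases D <;> cases D' <;> rfl

end LocalTriMuDatum

variable {V : Type u} {P : PlaceData V} {G : V → Type u} [∀ v, Group (G v)]
  {X : ∀ v, GroupTheoreticUnits.{u, w} (G v)}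

/-! ### 0'. Objects of the realified global Frobenioid up to isomorphism -/

namespace RealifiedGlobalFrobenioidF

variable {V : Type u} (C : RealifiedGlobalFrobenioidF.{u, v} V)

/-- The isomorphism relation of `*C^⊩` as a setoid. [cite: Mochizuki2012, Def 4.9 (viii) p.158] -/
def isoSetoid : Setoid C.Obj := ⟨C.Iso, C.iso_equivalence⟩

/-- Isomorphism classes of objects of `*C^⊩`. [cite: Mochizuki2012, Def 4.9 (viii) p.158] -/
def IsoClass : Type v := Quotient C.isoSetoid

/-- The class of an object. [cite: Mochizuki2012, Def 4.9 (viii) p.158] -/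
def classOf (a : C.Obj) : C.IsoClass := Quotient.mk C.isoSetoid a

/-- Two objects have the same class iff they are isomorphic. [cite: Mochizuki2012, Def 4.9 (viii) p.158] -/
theorem classOf_eq_classOf_iff (a b : C.Obj) : C.classOf a = C.classOf b ↔ C.Iso a b := Quotient.eq (r := C.isoSetoid)

/-- `classOf` is surjective. [cite: Mochizuki2012, Def 4.9 (viii) p.158] -/
theorem classOf_surjective : Function.Surjective C.classOf := Quotient.mk_surjective

/-- The arithmetic degree on isomorphism classes (`deg_iso`). [cite: Mochizuki2012, Def 4.9 (viii) p.158] -/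
def degClass : C.IsoClass → ℝ := Quotient.lift C.deg fun a b h => C.deg_iso a b h

/-- `degClass [a] = deg a`. [cite: Mochizuki2012, Def 4.9 (viii) p.158] -/
@[simp] theorem degClass_classOf (a : C.Obj) : C.degClass (C.classOf a) = C.deg a := rfl

end RealifiedGlobalFrobenioidF

/-! ### 1. `F^{⊩▶×μ}`-prime-strips with print-level morphisms -/

/-- **An `F^{⊩▶×μ}`-prime-strip, print-level presentation** ([IUTchII] Def 4.9 (viii)): the Fintype-free record
`FVdashTriMuPrimeStripF` (realified global Frobenioid data, `F^{⊢▶×μ}`-prime-strip, valuations `ρ_v`, generators at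
bad places, pilot object), wrapped so that its morphisms are the printed isomorphisms of collections of data.
[cite: Mochizuki2012, Def 4.9 (viii) p.158] -/
structure FVdashSplitTriMuPrimeStrip (P : PlaceData V) (G : V → Type u) [∀ v, Group (G v)]
    (X : ∀ v, GroupTheoreticUnits.{u, w} (G v)) : Type (max u (v + 1) w) where
  /-- the underlying collection of data -/
  data : FVdashTriMuPrimeStripF.{u, v, w} P G X

namespace FVdashSplitTriMuPrimeStrip

/-- **A morphism of `F^{⊩▶×μ}`-prime-strips** (Def 4.9 (viii) "an isomorphism between collections of data"; LOCAL part
at print level, GLOBAL part LOOSER than print — total degree and pilot class only, see the file-header DISCLOSURE):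
a bijection of the isomorphism classes of objects of `*C^⊩` respecting (total) degrees and carrying the pilot
class to the pilot class, `V`-indexed SPLIT isomorphisms of the local `F^{⊢▶×μ}`-data, compatible with the
valuations `ρ_v` on `O^▶` and with the distinguished generators at bad places. [cite: Mochizuki2012, Def 4.9 (viii) p.158] -/
structure Hom (S T : FVdashSplitTriMuPrimeStrip.{u, v, w} P G X) : Type (max u v w) where
  /-- the bijection on ISOMORPHISM CLASSES of objects of the realified global Frobenioids -/
  classEquiv : S.data.realifiedF.IsoClass ≃ T.data.realifiedF.IsoClass
  /-- it respects degrees -/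
  degClass_eq : ∀ c, T.data.realifiedF.degClass (classEquiv c) = S.data.realifiedF.degClass c
  /-- pilot class to pilot class -/
  map_pilotClass : classEquiv (S.data.realifiedF.classOf S.data.pilot) = T.data.realifiedF.classOf T.data.pilot
  /-- the local split isomorphisms of the `F^{⊢▶×μ}`-data -/
  locSplitIso : ∀ v : V, LocalTriMuDatum.SplitIso (S.data.strip.localDatum v) (T.data.strip.localDatum v)
  /-- compatibility with the valuations `ρ_v : O^▶ → ℝ_{≥0}` -/
  map_rho : ∀ (v : V) (a : OTri (S.data.strip.localDatum v).O),
    T.data.rho v ((locSplitIso v).eTri a) = S.data.rho v a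
  /-- the distinguished generators of `O^▶` at bad places correspond -/
  map_triGen : ∀ (v : V) (h : P.kind v = PlaceKind.bad), (locSplitIso v).eTri (S.data.triGen v h) = T.data.triGen v h

namespace Hom

variable {S T U : FVdashSplitTriMuPrimeStrip.{u, v, w} P G X}

/-- A morphism is determined by its class bijection and its local split isomorphisms. (bookkeeping).
[cite: Mochizuki2012, Def 4.9 (viii) p.158] -/
theorem ext' {f g : Hom S T} (h₁ : f.classEquiv = g.classEquiv) (h₂ : f.locSplitIso = g.locSplitIso) : f = g := by
  cases f; cases g; cases h₁; cases h₂; rfl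

/-- Identity morphism. [cite: Mochizuki2012, Def 4.9 (viii) p.158] -/
def id (S : FVdashSplitTriMuPrimeStrip.{u, v, w} P G X) : Hom S S where
  classEquiv := Equiv.refl _
  degClass_eq _ := rfl
  map_pilotClass := rfl
  locSplitIso _ := LocalTriMuDatum.SplitIso.refl _
  map_rho v a := by rw [LocalTriMuDatum.SplitIso.eTri_refl, MulEquiv.refl_apply]
  map_triGen v h := by rw [LocalTriMuDatum.SplitIso.eTri_refl, MulEquiv.refl_apply]

/-- Composite morphism. [cite: Mochizuki2012, Def 4.9 (viii) p.158] -/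
def comp (f : Hom S T) (g : Hom T U) : Hom S U where
  classEquiv := f.classEquiv.trans g.classEquiv
  degClass_eq c := by rw [Equiv.trans_apply, g.degClass_eq, f.degClass_eq]
  map_pilotClass := by rw [Equiv.trans_apply, f.map_pilotClass, g.map_pilotClass]
  locSplitIso v := (f.locSplitIso v).trans (g.locSplitIso v)
  map_rho v a := by rw [LocalTriMuDatum.SplitIso.eTri_trans, MulEquiv.trans_apply, g.map_rho, f.map_rho]
  map_triGen v h := by rw [LocalTriMuDatum.SplitIso.eTri_trans, MulEquiv.trans_apply, f.map_triGen, g.map_triGen]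

/-- Inverse morphism. [cite: Mochizuki2012, Def 4.9 (viii) p.158] -/
def inv (f : Hom S T) : Hom T S where
  classEquiv := f.classEquiv.symm
  degClass_eq c := by rw [← f.degClass_eq, Equiv.apply_symm_apply]
  map_pilotClass := by rw [Equiv.symm_apply_eq, f.map_pilotClass]
  locSplitIso v := (f.locSplitIso v).symm
  map_rho v b := by
    rw [LocalTriMuDatum.SplitIso.eTri_symm, ← f.map_rho v ((f.locSplitIso v).eTri.symm b), MulEquiv.apply_symm_apply]
  map_triGen v h := by
    rw [LocalTriMuDatum.SplitIso.eTri_symm, MulEquiv.symm_apply_eq, f.map_triGen]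

/-- A morphism identifies the (negative) degrees of the pilot objects. [cite: Mochizuki2012, Def 4.9 (viii) p.158] -/
theorem pilot_deg_eq (f : Hom S T) : S.data.realifiedF.deg S.data.pilot = T.data.realifiedF.deg T.data.pilot := by
  rw [← RealifiedGlobalFrobenioidF.degClass_classOf, ← RealifiedGlobalFrobenioidF.degClass_classOf,
    ← f.map_pilotClass, f.degClass_eq]

/-- The valuation of the image of the generator is the valuation of the generator (`ρ`-compatibility at the
distinguished element; the quantity that determines the pilot object's local degree). [cite: Mochizuki2012, Def 4.9 (viii) p.158] -/
theorem rho_triGen_eq (f : Hom S T) (v : V) (h : P.kind v = PlaceKind.bad) :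
    T.data.rho v (T.data.triGen v h) = S.data.rho v (S.data.triGen v h) := by
  rw [← f.map_triGen v h, f.map_rho]

end Hom

/-- **IUTchII Def 4.9 (viii) p. 158, print level: the groupoid of `F^{⊩▶×μ}`-prime-strips.**
[cite: Mochizuki2012, Def 4.9 (viii) p.158] -/
instance instGroupoid : Groupoid (FVdashSplitTriMuPrimeStrip.{u, v, w} P G X) where
  Hom := Hom
  id := Hom.id
  comp := Hom.comp
  id_comp f := Hom.ext' (Equiv.ext fun _ => rfl)
    (funext fun v => LocalTriMuDatum.SplitIso.refl_trans (f.locSplitIso v))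
  comp_id f := Hom.ext' (Equiv.ext fun _ => rfl)
    (funext fun v => LocalTriMuDatum.SplitIso.trans_refl (f.locSplitIso v))
  assoc f g h := Hom.ext' (Equiv.ext fun _ => rfl)
    (funext fun v => LocalTriMuDatum.SplitIso.trans_assoc (f.locSplitIso v) (g.locSplitIso v) (h.locSplitIso v))
  inv := Hom.inv
  inv_comp f := Hom.ext' (Equiv.ext fun x => f.classEquiv.apply_symm_apply x)
    (funext fun v => LocalTriMuDatum.SplitIso.symm_trans (f.locSplitIso v))
  comp_inv f := Hom.ext' (Equiv.ext fun x => f.classEquiv.symm_apply_apply x)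
    (funext fun v => LocalTriMuDatum.SplitIso.trans_symm (f.locSplitIso v))

/-- **Forgetting to the `F^{⊢▶×μ}`-prime-strip** at print level, as a functor (the `StripFrame.FglxmToFvtxm` shape).
[cite: Mochizuki2012, Def 4.9 (viii) p.158] -/
def toSplitStripFunctor : FVdashSplitTriMuPrimeStrip.{u, v, w} P G X ⥤ FSplitTriMuPrimeStrip.{u, v, w} P G X where
  obj S := ⟨S.data.strip⟩
  map f := f.locSplitIso
  map_id _ := rfl
  map_comp _ _ := rfl

/-- On objects it is the underlying `F^{⊢▶×μ}`-prime-strip. [cite: Mochizuki2012, Def 4.9 (viii) p.158] -/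
@[simp] theorem toSplitStripFunctor_obj (S : FVdashSplitTriMuPrimeStrip.{u, v, w} P G X) :
    (toSplitStripFunctor.obj S).data = S.data.strip := rfl

/-- On morphisms it is the local part. [cite: Mochizuki2012, Def 4.9 (viii) p.158] -/
@[simp] theorem toSplitStripFunctor_map {S T : FVdashSplitTriMuPrimeStrip.{u, v, w} P G X} (f : S ⟶ T) :
    toSplitStripFunctor.map f = f.locSplitIso := rfl

/-- KIT-RULE connectedness for print-level `F^{⊩▶×μ}`-prime-strips ("isomorphic to `‡F^{⊩▶×μ}`", Def 4.9 (viii); the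
`StripFrame.iso_nonempty_Fglxm` shape). [cite: Mochizuki2012, Def 4.9 (viii) p.158] -/
theorem iso_nonempty_of_model (M : FVdashSplitTriMuPrimeStrip.{u, v, w} P G X)
    (h : ∀ S : FVdashSplitTriMuPrimeStrip.{u, v, w} P G X, Nonempty (S ≅ M))
    (S T : FVdashSplitTriMuPrimeStrip.{u, v, w} P G X) : Nonempty (S ≅ T) := by
  obtain ⟨e⟩ := h S
  obtain ⟨e'⟩ := h T
  exact ⟨e ≪≫ e'.symm⟩

/-- Isomorphic print-level `F^{⊩▶×μ}`-prime-strips have pilot objects of the same (negative) degree.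
[cite: Mochizuki2012, Def 4.9 (viii) p.158] -/
theorem pilot_deg_eq_of_iso {S T : FVdashSplitTriMuPrimeStrip.{u, v, w} P G X} (e : S ≅ T) :
    S.data.realifiedF.deg S.data.pilot = T.data.realifiedF.deg T.data.pilot :=
  Hom.pilot_deg_eq e.hom

end FVdashSplitTriMuPrimeStrip

end Literature.IUT.HodgeArakelov
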